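import Summits.ABC.IUTFork.Repair.RHOffSigmaTolerance
import Summits.ABC.IUTFork.Conditional.AbcOfCor312Slack
import HarnessLib

/-!
# R-H ROUND 2, Q1 (cell/packet-strata rows 3/4/5; seat abc-iut-rh2-xi-1): the MULTIPLICATIVE abc-tolerance of the off-Σ remainder, I —
# [IUTchIV] Thm. 1.10's display survives the squeeze DILATED by `(1 − κ)⁻¹`, `κ ≤ 1/(2l)`, with print's OWN constants (Step (viii) re-run
# with the EXACT coefficient `(l+1)/24 − 1/(2l)`); beyond that, a fixed `κ` lowers the display's `1/6` to `(1 − κ)/6`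

PROOF-ONLY sequel (no `def`, no new `Prop`, no instance, no notation; nothing re-typed) of this seat's `RHOffSigmaTolerance.lean`
(p469145: «Cor. 3.12 up to `B`» `T.negAbsLogQ − B ≤ T.negLogTheta` at a genuine Θ-volume datum, the kernel target
`OffSigmaTolerance κ A T B := B ≤ κ·T.gap + A`, `gap_le_of_tolerance`) and of abc-iut-rh2-q2-cond's `Conditional/AbcOfCor312Slack.lean`
(p469667: the ADDITIVE tolerance — Step (viii) survives a slack `E ≤ Tol(P,l) := ((l+1)/4)·5·(d*·l + η_prm)`, `display_of_squeezeIII_slack`,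
`display_arith`). Rung LADDER-ABC:A2.RESCUE.H, R-H round 2 (director-abc g3 tranche 1 (7); ROUND2/START-HERE v1.2 §0b ruling R3: the rows-3/4/5
word is booked on the per-datum number `ρ_r(T) = E_off⁺(Σ_r)/gap(T)` with the PRE-REGISTERED bins `ρ = 0` MOOT · `0 < ρ ≤ 1/l` exponent kept,
constant worse · `1/l < ρ < 1` exponent `×1/(1−ρ)` · `ρ ≥ 1` squeeze EMPTY; ruling R11 quotes «`θ(l) ≤ c/l` absorbed»). TAKES NO SIDE on [IUTchIII] Cor. 3.12 or on any author; typed ≠ proved;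
instantiated ≠ endorsed.

THE QUESTION THIS FILE SETTLES. The additive doors of record (q2-cond p469667 `Tol`, rh-typ-5 p470106 `τ`) absorb an off-Σ remainder that is
`O(d_mod·l²)` in the currency of `−|log(Θ)|`; a remainder proportional to the datum's own `T.gap = ((l+1)/24 − 1/(2l))·log(q)` — which is
what the ratio `ρ` measures — was so far PROSE («a fixed fraction moves the exponent; `θ(l) ≤ c/l` is absorbed»). **How large a MULTIPLE
`κ·T.gap` does Step (viii) of [IUTchIV] Thm. 1.10 absorb with NO change of ANY constant of print's display, ON TOP of the additive `Tol`, at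
EVERY admissible `(P, l)`?** ANSWER (kernel): every `κ ≤ 1/(2l)`, uniformly in `l ≥ 7` prime and `d_mod ≥ 1`. Reason (pp. 30–31 and the last
paragraph of the proof, p. 31): the squeeze's EXACT coefficient is `(l+1)/24 − 1/(2l) = ((l+1)/24)·(1 − 12/(l(l+1)))`; print rounds it to
`((l+1)/24)·(1 − 12/l²)` and then uses `(1 − 12/l²)⁻¹·(1 + 12·d_mod/l) ≤ 1 + 20·d_mod/l` and `(1 − 12/l²)⁻¹ ≤ 2`; with the exact coefficient
the two roundings leave room for the extra factor `(1 − κ)⁻¹`, `κ ≤ 1/(2l)` (`display_arith_mult`; binding at `l = 7`, margin `912/343` in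
`180`). NOT absorbed this way: `κ = c/l` with `c > 0.62` at `l = 7`, `d_mod = 1` (the `(log-diff + log-cond)`-coefficient `20·d_mod/l` would
have to grow — a Cor. 2.2 (ii) re-run, not an `η_prm`-shift); `c = 1` is absorbed from `l ≥ 11` on.
* §1 `display_arith_mult` — the last paragraph of the proof of Thm. 1.10 with the dilation: `7 ≤ l`, `1 ≤ d`, `κ ≤ 1/(2l)`,
  `(1 − κ)·(1/6)(1 − 12/(l(l+1)))·Q ≤ (1 + 12d/l)·L + (129/9)·E₁` ⟹ `(1/6)·Q ≤ (1 + 20d/l)·L + 20·E₁`;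
* §2 `collect_of_squeezeIII_dilated` (Step (viii) collected with the exact coefficient, any `κ`), **`display_of_squeezeIII_mult`** — `l ≥ 5`
  prime, `l ≠ 5`, `IsEtaPrm η_prm`, `κ ≤ 1/(2l)`, `E ≤ ((l+1)/4)·5·(d*·l + η_prm)` and the DILATED squeeze
  `(1 − κ)·((l+1)/24 − 1/(2l))·log(q) ≤ B_III(P,l) + E + ((l+5)/4)·log π` ⟹ `Cor22.Display P l η_prm` WITH PRINT'S CONSTANTS (`'`: the
  `η`-free `E ≤ ((l+1)/4)·5·d*·l`); **`display_dilated_of_squeezeIII`** — for ANY `κ ≤ 1` the dilated squeeze gives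
  `((1 − κ)/6)·log(q) ≤ (1 + 20·d_mod/l)·(log-diff + log-cond) + 20·(d*·l + η_prm)`: print's display with `1/6 ↦ (1−κ)/6`, the
  EXPONENT-loss shape (its Cor. 2.2 (ii) consequence, an `ABCExponentBound`-type statement, is not typed);
* the datum-level form (`(1 − κ)·T.gap ≤ δ + A + ((l+5)/4)·log π` from «Cor. 3.12 up to `B`» + `OffSigmaTolerance κ A T B`) and the
  `ABC` certificate are the sequel `RHOffSigmaToleranceMultAbc.lean`.
RELATION TO THE WINDOWED CERTIFICATE (abc-iut-rh2-q2-cond p472503 `Cor22.partII_of_displayWindow`, p473109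
`Cor312Slack.ABC_of_cor312Slack_rho_of_hullRegime`, landed while this file was written): Cor. 2.2 (ii) invokes the display ONLY where
`2^140 < log(q^∀)`, `√(log(q^∀)) ≤ l`; there `T.gap ≤ ((l+1)/24)·l²`, so a relative remainder `≤ (30·d*/l)·T.gap` is inside `Tol` and `ABC`
follows with no loss — FOR `ABC` that SUPERSEDES the whole `1/l` class. What THIS file adds is WINDOW-FREE: Thm. 1.10's display ITSELF
(`Cor22.Display` at EVERY admissible `(P, l)`, as print states Thm. 1.10) tolerates the share `κ ≤ 1/(2l)` with print's constants, the
ceiling of that room, and the exponent-loss display beyond it.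
READING FOR THE Q1 3/4/5 BINS (numbers, not adjectives): per admissible datum, an off-Σ deficit `E_off⁺ ≤ T.gap/(2l) + 691200·d_mod·l(l+1)`
(`η`-free) costs NOTHING for Thm. 1.10's display at that `(P, l)`; inside Cor. 2.2 (ii)'s window even `E_off⁺ ≤ (30·d*/l)·T.gap` costs nothing
for `ABC` (p473109); a FIXED fraction `ρ` lowers `1/6` to `(1−ρ)/6` (exponent); `ρ ≥ 1`: the squeeze is empty (`cor312UpTo_trivial`, p469145).
On the tabulated genuine data (abc-iut-rh-kit-2 PASS 18 j261644, 565 (datum, l), `l ≤ 397`) `E_off⁺(Σ₄)/Tol ≤ 7.3·10⁻⁷` throughout while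
`ρ₄ = E_off⁺/gap` has median `0.16`, max `0.39` and `l·ρ₄` RISES with `l` — all of them far below the window `log(q^∀) > 2^140`, so the tables
neither exercise nor contradict any certificate. HONEST SCOPE: pure arithmetic over assumption-labelled inequalities; nothing here asserts that
abc is proved or refuted, or that Cor. 3.12 (weakened or not) holds at any datum; typed ≠ proved; computed ≠ proved; instantiated ≠ endorsed.
[cite: Mochizuki2012, IUTchIV Thm. 1.10 pp. 22–31, Step (viii) pp. 30–31, last paragraph p. 31; Prop. 1.6 p. 16; Cor. 2.2 (ii) pp. 41–48]
[cite: Mochizuki2012, IUTchIII Cor. 3.12 p. 173–174, Step (xi-f) p. 184] [claim: Mochizuki2012, status: disputed]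
Axioms: standard.
-/

noncomputable section

namespace Summit.ABC.IUTFork.Repair.RH.OffSigma

open Literature.IUT.LogVolume Literature.IUT.HodgeTheaters Literature.NumberTheory.DiophantineGeometry.GenEll
open Summit.ABC.ABC.Theorems Summit.ABC.IUTFork.Conditional NumberField IsDedekindDomain

/-! ## §1 The last paragraph of [IUTchIV] Thm. 1.10's proof WITH THE DILATION `(1 − κ)`, `κ ≤ 1/(2l)` -/

/-- **The last paragraph of the proof of [IUTchIV] Thm. 1.10 (p. 31) WITH THE EXACT COEFFICIENT AND THE DILATION, as real arithmetic**:
for `l ≥ 7`, `d ≥ 1`, `L ≥ 0`, `E₁ > 0`, `κ ≤ 1/(2l)` (any real `Q`), `(1 − κ)·(1/6)(1 − 12/(l(l+1)))·Q ≤ (1 + 12d/l)·L + (129/9)·E₁` implies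
`(1/6)·Q ≤ (1 + 20d/l)·L + 20·E₁` — print's two roundings have this much room once `1 − 12/l²` is replaced by the exact `1 − 12/(l(l+1))`
(`t = 1/l ≤ 1/7`, `d ≥ 1`: `(1+12dt)(1+t) ≤ (1+20dt)(1−t/2)(1+t−12t²)` and `129(1+t) ≤ 180(1−t/2)(1+t−12t²)`).
[cite: Mochizuki2012, IUTchIV Thm. 1.10 proof, last paragraph p. 31] [claim: Mochizuki2012, status: disputed] -/
theorem display_arith_mult {l d L Q E₁ κ : ℝ} (hl7 : 7 ≤ l) (hd1 : 1 ≤ d) (hL : 0 ≤ L) (hE₁ : 0 < E₁)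
    (hκ : κ ≤ 1 / (2 * l))
    (h : (1 - κ) * (1 / 6 * (1 - 12 / (l * (l + 1)))) * Q ≤ (1 + 12 * d / l) * L + 129 / 9 * E₁) :
    1 / 6 * Q ≤ (1 + 20 * d / l) * L + 20 * E₁ := by
  have hl0 : 0 < l := by linarith
  set t : ℝ := 1 / l with ht
  have ht0 : 0 < t := by rw [ht]; positivity
  have ht7 : t ≤ 1 / 7 := by rw [ht]; exact one_div_le_one_div_of_le (by norm_num) hl7
  have hκt : κ ≤ t / 2 := by
    have e0 : 1 / (2 * l) = t / 2 := by rw [ht]; ring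
    rw [← e0]
    exact hκ
  have e1 : 12 * d / l = 12 * d * t := by rw [ht]; ring
  have e2 : 12 / (l * (l + 1)) = 12 * t ^ 2 / (1 + t) := by
    rw [ht, div_eq_div_iff (by positivity) (by positivity)]
    field_simp
  have e3 : 20 * d / l = 20 * d * t := by rw [ht]; ring
  rw [e1, e2] at h
  rw [e3]
  have ht2 : t ^ 2 ≤ 1 / 49 := by nlinarith
  have h1t : 0 < 1 + t := by linarith
  have hu0 : 0 < 1 + t - 12 * t ^ 2 := by nlinarith
  -- the dilated exact coefficient `g := (1 − κ)·(1 − 12t²/(1+t)) = (1 − κ)(1 + t − 12t²)/(1 + t) > 0`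
  have eg : (1 - κ) * (1 - 12 * t ^ 2 / (1 + t)) = (1 - κ) * (1 + t - 12 * t ^ 2) / (1 + t) := by
    rw [one_sub_div h1t.ne', mul_div_assoc]
  have hκ1 : 0 < 1 - κ := by linarith
  have hg0 : 0 < (1 - κ) * (1 - 12 * t ^ 2 / (1 + t)) := by
    rw [eg]
    positivity
  have hstep : 1 / 6 * Q * ((1 - κ) * (1 - 12 * t ^ 2 / (1 + t))) ≤ (1 + 12 * d * t) * L + 129 / 9 * E₁ := by linarith
  -- (a) the `L`-coefficient: `(1 + 12dt) ≤ (1 + 20dt)·g`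
  have ht3 : 0 ≤ t ^ 3 := by positivity
  have hD : 0 ≤ 8 - 2 * t - 250 * t ^ 2 + 120 * t ^ 3 := by linarith
  have hr : 0 ≤ 15 / 2 - 29 / 2 * t - 244 * t ^ 2 + 120 * t ^ 3 := by linarith
  have hA : (1 + 12 * d * t) * (1 + t) ≤ (1 + 20 * d * t) * (1 - t / 2) * (1 + t - 12 * t ^ 2) := by
    have hdD := mul_nonneg (sub_nonneg.2 hd1) hD
    have hprod := mul_nonneg ht0.le (add_nonneg hr hdD)
    have expand : (1 + 20 * d * t) * (1 - t / 2) * (1 + t - 12 * t ^ 2) - (1 + 12 * d * t) * (1 + t) =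
        t * ((15 / 2 - 29 / 2 * t - 244 * t ^ 2 + 120 * t ^ 3) + (d - 1) * (8 - 2 * t - 250 * t ^ 2 + 120 * t ^ 3)) := by
      ring
    linarith
  have hB : (1 + 12 * d * t) * (1 + t) ≤ (1 + 20 * d * t) * ((1 - κ) * (1 + t - 12 * t ^ 2)) := by
    have hpos : 0 ≤ (1 + 20 * d * t) * (1 + t - 12 * t ^ 2) := by positivity
    have hmono := mul_le_mul_of_nonneg_left (show 1 - t / 2 ≤ 1 - κ by linarith) hpos
    have expand1 : (1 + 20 * d * t) * (1 + t - 12 * t ^ 2) * (1 - t / 2) =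
        (1 + 20 * d * t) * (1 - t / 2) * (1 + t - 12 * t ^ 2) := by ring
    have expand2 : (1 + 20 * d * t) * (1 + t - 12 * t ^ 2) * (1 - κ) =
        (1 + 20 * d * t) * ((1 - κ) * (1 + t - 12 * t ^ 2)) := by ring
    linarith
  have hc1 : (1 + 12 * d * t) ≤ (1 + 20 * d * t) * ((1 - κ) * (1 - 12 * t ^ 2 / (1 + t))) := by
    have e : (1 + 20 * d * t) * ((1 - κ) * (1 - 12 * t ^ 2 / (1 + t))) =
        (1 + 20 * d * t) * ((1 - κ) * (1 + t - 12 * t ^ 2)) / (1 + t) := by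
      rw [eg]; ring
    rw [e, le_div_iff₀ h1t]
    exact hB
  -- (b) the constant: `129/9 ≤ 20·g` (binding at `l = 7`, margin `912/343` in `180`)
  have hp : 0 ≤ 51 - 39 * t - 2250 * t ^ 2 + 1080 * t ^ 3 := by
    have hq : 0 ≤ 16581 / 49 + 14670 / 7 * t - 1080 * t ^ 2 := by linarith
    have hprod := mul_nonneg (sub_nonneg.2 ht7) hq
    have expand : 51 - 39 * t - 2250 * t ^ 2 + 1080 * t ^ 3 =
        912 / 343 + (1 / 7 - t) * (16581 / 49 + 14670 / 7 * t - 1080 * t ^ 2) := by ring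
    rw [expand]
    linarith
  have hB2 : 129 * (1 + t) ≤ 180 * ((1 - κ) * (1 + t - 12 * t ^ 2)) := by
    have hmono := mul_le_mul_of_nonneg_left (show 1 - t / 2 ≤ 1 - κ by linarith) hu0.le
    have expand : 180 * ((1 + t - 12 * t ^ 2) * (1 - t / 2)) - 129 * (1 + t) =
        51 - 39 * t - 2250 * t ^ 2 + 1080 * t ^ 3 := by ring
    nlinarith
  have hc2 : (129 / 9 : ℝ) ≤ 20 * ((1 - κ) * (1 - 12 * t ^ 2 / (1 + t))) := by
    have e : 20 * ((1 - κ) * (1 - 12 * t ^ 2 / (1 + t))) = 20 * ((1 - κ) * (1 + t - 12 * t ^ 2)) / (1 + t) := by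
      rw [eg]; ring
    rw [e, le_div_iff₀ h1t]
    linarith
  -- collect and divide by `g`
  have key : (1 + 12 * d * t) * L + 129 / 9 * E₁ ≤
      ((1 + 20 * d * t) * L + 20 * E₁) * ((1 - κ) * (1 - 12 * t ^ 2 / (1 + t))) := by
    have a1 := mul_le_mul_of_nonneg_right hc1 hL
    have a2 := mul_le_mul_of_nonneg_right hc2 hE₁.le
    have expand : ((1 + 20 * d * t) * L + 20 * E₁) * ((1 - κ) * (1 - 12 * t ^ 2 / (1 + t))) =
        (1 + 20 * d * t) * ((1 - κ) * (1 - 12 * t ^ 2 / (1 + t))) * L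
          + 20 * ((1 - κ) * (1 - 12 * t ^ 2 / (1 + t))) * E₁ := by ring
    rw [expand]
    linarith
  exact le_of_mul_le_mul_right (le_trans hstep key) hg0

/-! ## §2 Step (viii) of [IUTchIV] Thm. 1.10 at a point, constant `B_III`, additive slack `E ≤ Tol`, AND the dilation `(1 − κ)⁻¹` -/

/-- **Step (viii) COLLECTED, with the exact coefficient and an arbitrary dilation `(1 − κ)`** ([IUTchIV] Thm. 1.10 pp. 30–31): the dilated
squeeze with `E ≤ ((l+1)/4)·5·(d*·l + η_prm)`, `l ≥ 5` prime, `l ≠ 5`, `IsEtaPrm η_prm` gives `(1 − κ)·(1/6)·(1 − 12/(l(l+1)))·log(q) ≤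
(1 + 12·d_mod/l)·(log-diff + log-cond) + (129/9)·(d*·l + η_prm)` — Step (vii) `(l+5)/4·log π ≤ (l+1)/4·4`, Prop. 1.6 (PROVED
`log_mul_primeCounting_le_of_isEtaPrm`), `2·log l + 56 ≤ (4/9)·d*·l`, and the EXACT identity `(l+1)/4·(1/6)·(1 − 12/(l(l+1))) = (l+1)/24 − 1/(2l)`
(print rounds to `1 − 12/l²`; the difference is the room §1 spends); skeleton = abc-iut-rh2-q2-cond's `Cor312Slack.display_of_squeezeIII_slack`;
no condition on `κ`. Pure arithmetic; no side taken. [cite: Mochizuki2012, IUTchIV Thm. 1.10 Steps (vii)–(viii) p. 30–31; Prop. 1.6 p. 16] -/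
theorem collect_of_squeezeIII_dilated {P : NFPoint} {l : ℕ} (hl : l.Prime) (h5 : 5 ≤ l) (hne : l ≠ 5) {η : ℝ}
    (hη : IsEtaPrm η) {κ E : ℝ}
    (hE : E ≤ ((l : ℝ) + 1) / 4 * (5 * ((((2 ^ 12 * 3 ^ 3 * 5 * Cor22.dmod P : ℕ) : ℝ)) * l + η)))
    (hineq : (1 - κ) * ((((l : ℝ) + 1) / 24 - 1 / (2 * l)) * Cor22.logQAvoid P {2, l}) ≤
      ((l : ℝ) + 1) / 4 *
          ((1 + 12 * (Cor22.dmod P : ℝ) / l) * (P.logDiff + Cor22.logCondAvoid P {2, l})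
            + 2 * Real.log l + 52
            + 20 / 3 * Real.log (((2 ^ 12 * 3 ^ 3 * 5 * Cor22.dmod P : ℕ) : ℝ) * (l : ℝ))
              * (Nat.primeCounting (2 ^ 12 * 3 ^ 3 * 5 * Cor22.dmod P * l) : ℝ))
        + E + ThetaVolumeInput.archLogTheta l) :
    (1 - κ) * (1 / 6 * (1 - 12 / ((l : ℝ) * ((l : ℝ) + 1)))) * Cor22.logQAvoid P {2, l} ≤
      (1 + 12 * (Cor22.dmod P : ℝ) / l) * (P.logDiff + Cor22.logCondAvoid P {2, l})
        + 129 / 9 * ((((2 ^ 12 * 3 ^ 3 * 5 * Cor22.dmod P : ℕ) : ℝ)) * l + η) := by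
  have h7 : 7 ≤ l := Cor312Slack.seven_le_of_prime_of_ne_five hl h5 hne
  have hl7 : (7 : ℝ) ≤ l := by exact_mod_cast h7
  have hl0 : (0 : ℝ) < l := by linarith
  have hη0 : 0 < η := hη.1
  have hDst : (((2 ^ 12 * 3 ^ 3 * 5 * Cor22.dmod P : ℕ) : ℝ)) = 552960 * (Cor22.dmod P : ℝ) := by
    push_cast; ring
  have hd1 : (1 : ℝ) ≤ (Cor22.dmod P : ℝ) := by exact_mod_cast Cor22.dmod_pos P
  -- Prop. 1.6 (proved in the tree): `log(d*·l)·π(d*·l) ≤ (4/3)·(d*·l + η)`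
  have hpnt : Real.log ((((2 ^ 12 * 3 ^ 3 * 5 * Cor22.dmod P : ℕ) : ℝ)) * (l : ℝ))
      * (Nat.primeCounting (2 ^ 12 * 3 ^ 3 * 5 * Cor22.dmod P * l) : ℝ) ≤
      4 / 3 * ((((2 ^ 12 * 3 ^ 3 * 5 * Cor22.dmod P : ℕ) : ℝ)) * l + η) := by
    have h0 : (0 : ℝ) ≤ (((2 ^ 12 * 3 ^ 3 * 5 * Cor22.dmod P : ℕ) : ℝ)) * l := by positivity
    have h2 := log_mul_primeCounting_le_of_isEtaPrm hη h0
    rwa [show ⌊(((2 ^ 12 * 3 ^ 3 * 5 * Cor22.dmod P : ℕ) : ℝ)) * (l : ℝ)⌋₊ = 2 ^ 12 * 3 ^ 3 * 5 * Cor22.dmod P * l by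
      exact_mod_cast Nat.floor_natCast (2 ^ 12 * 3 ^ 3 * 5 * Cor22.dmod P * l)] at h2
  -- from here on the constant `d* = 2^12·3^3·5·d_mod` (as a real number) is an opaque atom `N = 552960·d_mod`
  generalize hN : (((2 ^ 12 * 3 ^ 3 * 5 * Cor22.dmod P : ℕ) : ℝ)) = N at hE hineq hpnt hDst ⊢
  -- Step (viii)'s absorption `2·log l + 56 ≤ (4/9)·d*·l ≤ (4/9)·(d*·l + η)` (`log l ≤ l − 1`, `d* ≥ 552960`)
  have habs : 2 * Real.log (l : ℝ) + 56 ≤ 4 / 9 * (N * l + η) := by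
    have hlogl : Real.log (l : ℝ) ≤ (l : ℝ) - 1 := Real.log_le_sub_one_of_pos hl0
    have hprod : (552960 : ℝ) * l ≤ N * l := by
      rw [hDst]
      exact mul_le_mul_of_nonneg_right (by nlinarith) hl0.le
    linarith
  -- Step (vii): `(l+5)/4·log π ≤ (l+1)/4·4`
  have harch : ThetaVolumeInput.archLogTheta l ≤ ((l : ℝ) + 1) / 4 * 4 := by
    unfold ThetaVolumeInput.archLogTheta
    have hpi := log_pi_le_two
    have h1 : ((l : ℝ) + 5) / 4 * Real.log Real.pi ≤ ((l : ℝ) + 5) / 4 * 2 :=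
      mul_le_mul_of_nonneg_left hpi (by positivity)
    linarith
  -- the prime-counting atom
  set W : ℝ := 20 / 3 * Real.log (N * (l : ℝ)) * (Nat.primeCounting (2 ^ 12 * 3 ^ 3 * 5 * Cor22.dmod P * l) : ℝ) with hW
  have hW' : W ≤ 20 / 3 * (4 / 3 * (N * l + η)) := by
    rw [hW, mul_assoc]
    exact mul_le_mul_of_nonneg_left hpnt (by norm_num)
  have hc : (0 : ℝ) < ((l : ℝ) + 1) / 4 := by positivity
  -- hypothesis + tolerance + Step (vii): everything to the right of `(l+1)/4·`
  have h1 : (1 - κ) * ((((l : ℝ) + 1) / 24 - 1 / (2 * l)) * Cor22.logQAvoid P {2, l}) ≤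
      ((l : ℝ) + 1) / 4 * ((1 + 12 * (Cor22.dmod P : ℝ) / l) * (P.logDiff + Cor22.logCondAvoid P {2, l})
        + 2 * Real.log l + 52 + W + 5 * (N * l + η) + 4) := by
    have e : ((l : ℝ) + 1) / 4 * ((1 + 12 * (Cor22.dmod P : ℝ) / l) * (P.logDiff + Cor22.logCondAvoid P {2, l})
        + 2 * Real.log l + 52 + W + 5 * (N * l + η) + 4) =
        ((l : ℝ) + 1) / 4 * ((1 + 12 * (Cor22.dmod P : ℝ) / l) * (P.logDiff + Cor22.logCondAvoid P {2, l})
          + 2 * Real.log l + 52 + W)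
          + ((l : ℝ) + 1) / 4 * (5 * (N * l + η)) + ((l : ℝ) + 1) / 4 * 4 := by
      ring
    rw [e]
    linarith
  -- the EXACT coefficient: `(l+1)/4·(1/6)·(1 − 12/(l(l+1))) = (l+1)/24 − 1/(2l)`
  have hcoef : ((l : ℝ) + 1) / 4 * (1 / 6 * (1 - 12 / ((l : ℝ) * ((l : ℝ) + 1)))) = ((l : ℝ) + 1) / 24 - 1 / (2 * l) := by
    field_simp
    ring
  have h2 : ((l : ℝ) + 1) / 4 * ((1 - κ) * (1 / 6 * (1 - 12 / ((l : ℝ) * ((l : ℝ) + 1)))) * Cor22.logQAvoid P {2, l}) =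
      (1 - κ) * ((((l : ℝ) + 1) / 24 - 1 / (2 * l)) * Cor22.logQAvoid P {2, l}) := by
    rw [← hcoef]
    ring
  have h3 : (1 - κ) * (1 / 6 * (1 - 12 / ((l : ℝ) * ((l : ℝ) + 1)))) * Cor22.logQAvoid P {2, l} ≤
      (1 + 12 * (Cor22.dmod P : ℝ) / l) * (P.logDiff + Cor22.logCondAvoid P {2, l})
        + 2 * Real.log l + 52 + W + 5 * (N * l + η) + 4 := by
    refine le_of_mul_le_mul_left ?_ hc
    rw [h2]
    exact h1
  -- collect: `(1 − κ)(1/6)(1 − 12/(l(l+1)))·log(q) ≤ (1 + 12d/l)·L + (129/9)·(d*·l + η)`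
  linarith [hW', habs, h3]

/-- **[IUTchIV] Thm. 1.10 Step (viii) at a point of the `λ`-line, constant `B_III`, WITH THE ADDITIVE TOLERANCE `E` AND THE MULTIPLICATIVE
TOLERANCE `κ ≤ 1/(2l)`** (pp. 30–31; last paragraph of the proof p. 31): the DILATED squeeze
`(1 − κ)·((l+1)/24 − 1/(2l))·log(q) ≤ B_III(P,l) + E + ((l+5)/4)·log π` (what «Cor. 3.12 up to `B`» with `B ≤ κ·T.gap + E` and the hull
estimate give, §3), `l ≥ 5` prime, `l ≠ 5`, `IsEtaPrm η_prm`, `κ ≤ 1/(2l)` (no sign condition on `κ` or `log(q)`) and `E ≤ ((l+1)/4)·5·(d*·l + η_prm)`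
imply `Cor22.Display P l η_prm` UNCHANGED (`collect_of_squeezeIII_dilated` + `display_arith_mult`). Pure arithmetic; no side taken.
[cite: Mochizuki2012, IUTchIV Thm. 1.10 Steps (vii)–(viii) p. 30–31; Prop. 1.6 p. 16] [claim: Mochizuki2012, status: disputed] -/
theorem display_of_squeezeIII_mult {P : NFPoint} {l : ℕ} (hl : l.Prime) (h5 : 5 ≤ l) (hne : l ≠ 5) {η : ℝ}
    (hη : IsEtaPrm η) {κ E : ℝ} (hκ : κ ≤ 1 / (2 * (l : ℝ)))
    (hE : E ≤ ((l : ℝ) + 1) / 4 * (5 * ((((2 ^ 12 * 3 ^ 3 * 5 * Cor22.dmod P : ℕ) : ℝ)) * l + η)))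
    (hineq : (1 - κ) * ((((l : ℝ) + 1) / 24 - 1 / (2 * l)) * Cor22.logQAvoid P {2, l}) ≤
      ((l : ℝ) + 1) / 4 *
          ((1 + 12 * (Cor22.dmod P : ℝ) / l) * (P.logDiff + Cor22.logCondAvoid P {2, l})
            + 2 * Real.log l + 52
            + 20 / 3 * Real.log (((2 ^ 12 * 3 ^ 3 * 5 * Cor22.dmod P : ℕ) : ℝ) * (l : ℝ))
              * (Nat.primeCounting (2 ^ 12 * 3 ^ 3 * 5 * Cor22.dmod P * l) : ℝ))
        + E + ThetaVolumeInput.archLogTheta l) :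
    Cor22.Display P l η := by
  have hLD : 0 ≤ P.logDiff := P.logDiff_nonneg
  have hLC : 0 ≤ Cor22.logCondAvoid P {2, l} := Cor22.logCondAvoid_nonneg P {2, l}
  have h7 : 7 ≤ l := Cor312Slack.seven_le_of_prime_of_ne_five hl h5 hne
  have hl7 : (7 : ℝ) ≤ l := by exact_mod_cast h7
  have hd1 : (1 : ℝ) ≤ (Cor22.dmod P : ℝ) := by exact_mod_cast Cor22.dmod_pos P
  have hη0 : 0 < η := hη.1
  have hDst : (((2 ^ 12 * 3 ^ 3 * 5 * Cor22.dmod P : ℕ) : ℝ)) = 552960 * (Cor22.dmod P : ℝ) := by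
    push_cast; ring
  have hE₁0 : 0 < (((2 ^ 12 * 3 ^ 3 * 5 * Cor22.dmod P : ℕ) : ℝ)) * l + η := by positivity
  have h4 := collect_of_squeezeIII_dilated hl h5 hne hη hE hineq
  have h5' := display_arith_mult hl7 hd1 (add_nonneg hLD hLC) hE₁0 hκ h4
  unfold Cor22.Display
  have e4 : 2 ^ 12 * 3 ^ 3 * 5 * (Cor22.dmod P : ℝ) * l + η = (((2 ^ 12 * 3 ^ 3 * 5 * Cor22.dmod P : ℕ) : ℝ)) * l + η := by
    rw [hDst]; ring
  rw [e4]
  exact h5'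

/-- **The `η`-free form** (valid for EVERY `η_prm` of Prop. 1.6, hence inside `Cor22.Thm110Legendre`): the dilated squeeze with
`κ ≤ 1/(2l)` and `E ≤ ((l+1)/4)·5·d*·l` imply `Cor22.Display P l η_prm`. [cite: Mochizuki2012, IUTchIV Thm. 1.10 Step (viii) p. 30–31]
[claim: Mochizuki2012, status: disputed] -/
theorem display_of_squeezeIII_mult' {P : NFPoint} {l : ℕ} (hl : l.Prime) (h5 : 5 ≤ l) (hne : l ≠ 5) {η : ℝ}
    (hη : IsEtaPrm η) {κ E : ℝ} (hκ : κ ≤ 1 / (2 * (l : ℝ)))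
    (hE : E ≤ ((l : ℝ) + 1) / 4 * (5 * ((((2 ^ 12 * 3 ^ 3 * 5 * Cor22.dmod P : ℕ) : ℝ)) * l)))
    (hineq : (1 - κ) * ((((l : ℝ) + 1) / 24 - 1 / (2 * l)) * Cor22.logQAvoid P {2, l}) ≤
      ((l : ℝ) + 1) / 4 *
          ((1 + 12 * (Cor22.dmod P : ℝ) / l) * (P.logDiff + Cor22.logCondAvoid P {2, l})
            + 2 * Real.log l + 52
            + 20 / 3 * Real.log (((2 ^ 12 * 3 ^ 3 * 5 * Cor22.dmod P : ℕ) : ℝ) * (l : ℝ))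
              * (Nat.primeCounting (2 ^ 12 * 3 ^ 3 * 5 * Cor22.dmod P * l) : ℝ))
        + E + ThetaVolumeInput.archLogTheta l) :
    Cor22.Display P l η := by
  refine display_of_squeezeIII_mult hl h5 hne hη hκ (le_trans hE ?_) hineq
  have hη0 : 0 < η := hη.1
  have hc : (0 : ℝ) ≤ ((l : ℝ) + 1) / 4 := by positivity
  exact mul_le_mul_of_nonneg_left (by nlinarith) hc

/-- **THE EXPONENT-LOSS DISPLAY** (the shape beyond `κ ≤ 1/(2l)`): for ANY dilation `κ ≤ 1` the dilated squeeze with `E ≤ ((l+1)/4)·5·(d*·l + η_prm)`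
gives print's display with `1/6` LOWERED TO `(1 − κ)/6`: `((1 − κ)/6)·log(q) ≤ (1 + 20·d_mod/l)·(log-diff + log-cond) + 20·(d*·l + η_prm)` — print's
own roundings (abc-iut-rh2-q2-cond's `Cor312Slack.display_arith`) applied to `Q := (1 − κ)·log(q)`. A FIXED fraction `κ` of the datum's gap spent
off Σ costs the COEFFICIENT `1/6` (downstream: the abc exponent), not a constant; the Cor. 2.2 (ii) consequence is not typed here. Pure arithmetic;
no side taken. [cite: Mochizuki2012, IUTchIV Thm. 1.10 Step (viii) p. 30–31, last paragraph p. 31] [claim: Mochizuki2012, status: disputed] -/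
theorem display_dilated_of_squeezeIII {P : NFPoint} {l : ℕ} (hl : l.Prime) (h5 : 5 ≤ l) (hne : l ≠ 5) {η : ℝ}
    (hη : IsEtaPrm η) {κ E : ℝ} (hκ1 : κ ≤ 1)
    (hE : E ≤ ((l : ℝ) + 1) / 4 * (5 * ((((2 ^ 12 * 3 ^ 3 * 5 * Cor22.dmod P : ℕ) : ℝ)) * l + η)))
    (hineq : (1 - κ) * ((((l : ℝ) + 1) / 24 - 1 / (2 * l)) * Cor22.logQAvoid P {2, l}) ≤
      ((l : ℝ) + 1) / 4 *
          ((1 + 12 * (Cor22.dmod P : ℝ) / l) * (P.logDiff + Cor22.logCondAvoid P {2, l})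
            + 2 * Real.log l + 52
            + 20 / 3 * Real.log (((2 ^ 12 * 3 ^ 3 * 5 * Cor22.dmod P : ℕ) : ℝ) * (l : ℝ))
              * (Nat.primeCounting (2 ^ 12 * 3 ^ 3 * 5 * Cor22.dmod P * l) : ℝ))
        + E + ThetaVolumeInput.archLogTheta l) :
    (1 - κ) * (1 / 6 * Cor22.logQAvoid P {2, l}) ≤
      (1 + 20 * (Cor22.dmod P : ℝ) / l) * (P.logDiff + Cor22.logCondAvoid P {2, l})
        + 20 * (2 ^ 12 * 3 ^ 3 * 5 * (Cor22.dmod P : ℝ) * l + η) := by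
  have hLD : 0 ≤ P.logDiff := P.logDiff_nonneg
  have hLC : 0 ≤ Cor22.logCondAvoid P {2, l} := Cor22.logCondAvoid_nonneg P {2, l}
  have h7 : 7 ≤ l := Cor312Slack.seven_le_of_prime_of_ne_five hl h5 hne
  have hl7 : (7 : ℝ) ≤ l := by exact_mod_cast h7
  have hl0 : (0 : ℝ) < l := by linarith
  have hd1 : (1 : ℝ) ≤ (Cor22.dmod P : ℝ) := by exact_mod_cast Cor22.dmod_pos P
  have hη0 : 0 < η := hη.1
  have hDst : (((2 ^ 12 * 3 ^ 3 * 5 * Cor22.dmod P : ℕ) : ℝ)) = 552960 * (Cor22.dmod P : ℝ) := by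
    push_cast; ring
  have hE₁0 : 0 < (((2 ^ 12 * 3 ^ 3 * 5 * Cor22.dmod P : ℕ) : ℝ)) * l + η := by positivity
  have h4 := collect_of_squeezeIII_dilated hl h5 hne hη hE hineq
  have hq0 : 0 ≤ Cor22.logQAvoid P {2, l} := Cor22.logQAvoid_nonneg P {2, l}
  have hQ0 : 0 ≤ (1 - κ) * Cor22.logQAvoid P {2, l} := mul_nonneg (sub_nonneg.2 hκ1) hq0
  -- print's lossy coefficient is below the exact one: `1 − 12/l² ≤ 1 − 12/(l(l+1))`
  have hcmp : 1 - 12 / (l : ℝ) ^ 2 ≤ 1 - 12 / ((l : ℝ) * ((l : ℝ) + 1)) := by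
    have h : 12 / ((l : ℝ) * ((l : ℝ) + 1)) ≤ 12 / (l : ℝ) ^ 2 :=
      div_le_div_of_nonneg_left (by norm_num) (by positivity) (by nlinarith)
    linarith
  have h4' : 1 / 6 * (1 - 12 / (l : ℝ) ^ 2) * ((1 - κ) * Cor22.logQAvoid P {2, l}) ≤
      (1 + 12 * (Cor22.dmod P : ℝ) / l) * (P.logDiff + Cor22.logCondAvoid P {2, l})
        + 129 / 9 * ((((2 ^ 12 * 3 ^ 3 * 5 * Cor22.dmod P : ℕ) : ℝ)) * l + η) := by
    calc 1 / 6 * (1 - 12 / (l : ℝ) ^ 2) * ((1 - κ) * Cor22.logQAvoid P {2, l})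
        ≤ 1 / 6 * (1 - 12 / ((l : ℝ) * ((l : ℝ) + 1))) * ((1 - κ) * Cor22.logQAvoid P {2, l}) :=
          mul_le_mul_of_nonneg_right (mul_le_mul_of_nonneg_left hcmp (by norm_num)) hQ0
      _ = (1 - κ) * (1 / 6 * (1 - 12 / ((l : ℝ) * ((l : ℝ) + 1)))) * Cor22.logQAvoid P {2, l} := by ring
      _ ≤ _ := h4
  have e4 : 2 ^ 12 * 3 ^ 3 * 5 * (Cor22.dmod P : ℝ) * l + η = (((2 ^ 12 * 3 ^ 3 * 5 * Cor22.dmod P : ℕ) : ℝ)) * l + η := by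
    rw [hDst]; ring
  rw [e4]
  rcases hQ0.eq_or_lt with h0 | hpos
  · -- `(1 − κ)·log(q) = 0`: the right-hand side is nonnegative
    have e : (1 - κ) * (1 / 6 * Cor22.logQAvoid P {2, l}) = 0 := by
      rw [← mul_assoc, mul_comm (1 - κ), mul_assoc, ← h0, mul_zero]
    rw [e]
    positivity
  · have h5' := Cor312Slack.display_arith hl7 hd1 (add_nonneg hLD hLC) hpos hE₁0 h4'
    calc (1 - κ) * (1 / 6 * Cor22.logQAvoid P {2, l}) = 1 / 6 * ((1 - κ) * Cor22.logQAvoid P {2, l}) := by ring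
      _ ≤ _ := h5'

end Summit.ABC.IUTFork.Repair.RH.OffSigma

end
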